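import Mathlib
import Summits.HodgeConjecture.HodgeConjecture.Theorems.Ring2AbelianAllNonsplitWeilSurfaceQuaternion
import HarnessLib

/-!
# The index law on the type-II locus `𝔔(D₆)` of the non-split `(ℚ(√-3), (3,3))` Weil component:
# eigenspace exchange and «no degenerate divisor class» (WEIL-2 gen 23, LEMMA D)

research route, not a corollary; conditional on HC_CM plus one named minimal statement.

Cell `pub-hodge-ring2-ab-*` (ALL ABELIAN VARIETIES), seat WEIL-2 gen 23, §1 (LEMMA D) of
`run/shared/lean/pub/pub-hodge-ring2/pub-hodge-ring2-ab-weil-2/TWO-TERM-NOGO-G23.md`.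

On a member `Y` of the six-dimensional type-II locus `𝔔 ⊂ NonsplitSixfolds[ℚ(√-3), -2]` (abelian sixfolds
with multiplication by a maximal order of `D₆ = (-3,2)_ℚ ∋ K = ℚ(√-3)`), the rational Néron–Severi classes of
the `D₆`-plane are `ℓ = x·u + v`, `u = θ`, `v = E(ψ_v ·, ·)` with `ψ_v = (z + yφ)β ∈ D₆` Rosati-symmetric,
`ψ_v² = 2·Nm(v) = 2(z² + 3y²)` and `φ ψ_v = -ψ_v φ` (`φ² = -3`, `β² = 2`, `φβ = -βφ`).  The hermitian form of
`ℓ` is `H_u((x + ψ_v)·, ·)`, so the INDEX of `ℓ` is governed by the operator `x + ψ_v`.  This file proves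
the linear algebra of that operator over an arbitrary field and then specialises the scalar to the cell:

* `mapsTo_eigenspace_neg_of_anticommute`, `finrank_eigenspace_eq_finrank_eigenspace_neg_of_anticommute` —
  an invertible `φ` anticommuting with `ψ` exchanges the `μ`- and `(-μ)`-eigenspaces of `ψ`, which therefore
  have the same dimension (the multiplicities `(3,3)` of `±√(2Nm v)`: index `0`, `3` or `6`);
* `smul_one_add_mul_smul_one_sub`, `isUnit_smul_one_add_of_sq_ne` — `(x + ψ)(x - ψ) = (x² - c)·1` for
  `ψ² = c·1`, hence `x + ψ` is invertible whenever `x² ≠ c` (the class `xu + v` is NON-DEGENERATE);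
* `not_isUnit_smul_one_add_of_sq_eq` — conversely, if `x² = c ≠ 0` and some non-zero `φ` anticommutes with
  `ψ` (characteristic `0`), `x + ψ` is not invertible;
* `eigenspace_sup_eigenspace_neg_eq_top_of_sq`, `two_mul_finrank_eigenspace_eq_of_anticommute` — for
  `ψ² = r²·1`, `r ≠ 0`: `V = E_r ⊕ E_{-r}` and `2·dim E_r = dim V`;
* `isUnit_smul_one_add_of_sq_eq_two_mul_norm3` — THE CELL: if `ψ² = 2(z² + 3y²)·1` with `(y, z) ≠ 0` then
  `x + ψ` is invertible for EVERY rational `x`, because `x² = 2(z² + 3y²)` has no rational solution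
  (`norm3_ne_two_mul_norm3`, p304276: `2 ∉ Nm ℚ(√-3)ˣ`).  «No degenerate divisor class in the D₆-plane» —
  the hypothesis that makes THEOREM N of the account (two-term line-bundle objects remember their
  constituents) automatic on `𝔔`; on Markman's split side (`(-3,1)_ℚ`, `ψ² = Nm`) degenerate classes exist.

0 sorry, no `def`, no named fact; `HC_CM` does not occur.

## References

* [Mumford1970AbelianVarieties] D. Mumford, Abelian Varieties, §16 (index of a non-degenerate line bundle;
  vanishing of `H^i(L)` for `i ≠ index`) — context for the word «index», not re-proved here.
* [vanGeemen1994HodgeAV] B. van Geemen, An introduction to the Hodge conjecture for abelian varieties,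
  LNM 1594, (5.4.1), §5 — quaternion algebras attached to Weil-type data.
-/

namespace Summit.HodgeConjecture.Ring2AbelianAll.NonsplitTypeIIIndexLaw

open Module Module.End
open Summit.HodgeConjecture.Ring2AbelianAll.NonsplitWeilSurfaceQuaternion

variable {K V : Type*} [Field K] [AddCommGroup V] [Module K V]

/-- **Eigenspace exchange.** If `φ ∘ ψ = -ψ ∘ φ` then `φ` maps the `μ`-eigenspace of `ψ` into the
`(-μ)`-eigenspace.
research route, not a corollary; conditional on HC_CM plus one named minimal statement. [folklore] -/
theorem mapsTo_eigenspace_neg_of_anticommute {φ ψ : End K V} (h : φ * ψ = -(ψ * φ)) (μ : K) :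
    Set.MapsTo φ (eigenspace ψ μ) (eigenspace ψ (-μ)) := by
  intro v hv
  rw [SetLike.mem_coe, mem_eigenspace_iff] at hv ⊢
  have hφψ : φ (ψ v) = -(ψ (φ v)) := by
    have := LinearMap.congr_fun h v
    simpa using this
  rw [hv, map_smul] at hφψ
  rw [neg_smul]
  exact neg_eq_iff_eq_neg.mp hφψ.symm

/-- **Equal multiplicities.** If `φ` is injective and anticommutes with `ψ` on a finite-dimensional space,
the `μ`- and `(-μ)`-eigenspaces of `ψ` have the same dimension (for `ψ = ψ_v` on `T₀Y`, `dim = 6`: the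
eigenvalues `±√(2 Nm v)` both have multiplicity `3`, so the index of `x u + v` is `0`, `3` or `6`).
research route, not a corollary; conditional on HC_CM plus one named minimal statement. [folklore] -/
theorem finrank_eigenspace_eq_finrank_eigenspace_neg_of_anticommute [FiniteDimensional K V]
    {φ ψ : End K V} (h : φ * ψ = -(ψ * φ)) (hφ : Function.Injective φ) (μ : K) :
    finrank K (eigenspace ψ μ) = finrank K (eigenspace ψ (-μ)) := by
  have key : ∀ ν : K, finrank K (eigenspace ψ ν) ≤ finrank K (eigenspace ψ (-ν)) := fun ν => by
    refine LinearMap.finrank_le_finrank_of_injective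
      (f := φ.restrict (mapsTo_eigenspace_neg_of_anticommute h ν)) ?_
    intro a b hab
    apply Subtype.ext
    apply hφ
    have := congrArg Subtype.val hab
    simpa [LinearMap.restrict_apply] using this
  refine le_antisymm (key μ) ?_
  have h2 := key (-μ)
  rwa [neg_neg] at h2

/-- `(x·1 + ψ)(x·1 - ψ) = (x² - c)·1` when `ψ² = c·1`.
research route, not a corollary; conditional on HC_CM plus one named minimal statement. [folklore] -/
theorem smul_one_add_mul_smul_one_sub {ψ : End K V} {c : K} (hψ : ψ * ψ = c • (1 : End K V)) (x : K) :
    (x • (1 : End K V) + ψ) * (x • 1 - ψ) = (x ^ 2 - c) • (1 : End K V) := by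
  have e : (x • (1 : End K V) + ψ) * (x • 1 - ψ) = x ^ 2 • (1 : End K V) - ψ * ψ := by
    rw [add_mul, mul_sub, mul_sub, smul_mul_smul_comm, one_mul, mul_smul_comm, mul_one, smul_mul_assoc,
      one_mul, sq]
    abel
  rw [e, hψ, sub_smul]

/-- `(x·1 - ψ)(x·1 + ψ) = (x² - c)·1` when `ψ² = c·1`.
research route, not a corollary; conditional on HC_CM plus one named minimal statement. [folklore] -/
theorem smul_one_sub_mul_smul_one_add {ψ : End K V} {c : K} (hψ : ψ * ψ = c • (1 : End K V)) (x : K) :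
    (x • (1 : End K V) - ψ) * (x • 1 + ψ) = (x ^ 2 - c) • (1 : End K V) := by
  have e : (x • (1 : End K V) - ψ) * (x • 1 + ψ) = x ^ 2 • (1 : End K V) - ψ * ψ := by
    rw [sub_mul, mul_add, mul_add, smul_mul_smul_comm, one_mul, mul_smul_comm, mul_one, smul_mul_assoc,
      one_mul, sq]
    abel
  rw [e, hψ, sub_smul]

/-- **Non-degeneracy.** If `ψ² = c·1` and `x² ≠ c` then `x·1 + ψ` is invertible, with inverse
`(x² - c)⁻¹ (x·1 - ψ)`.  For `ψ = ψ_v`, `c = 2 Nm(v)`: the class `x u + v` is non-degenerate.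
research route, not a corollary; conditional on HC_CM plus one named minimal statement. [folklore] -/
theorem isUnit_smul_one_add_of_sq_ne {ψ : End K V} {c : K} (hψ : ψ * ψ = c • (1 : End K V)) {x : K}
    (hx : x ^ 2 ≠ c) : IsUnit (x • (1 : End K V) + ψ) := by
  have hne : x ^ 2 - c ≠ 0 := sub_ne_zero.mpr hx
  have hab : (x • (1 : End K V) + ψ) * ((x ^ 2 - c)⁻¹ • (x • 1 - ψ)) = 1 := by
    rw [mul_smul_comm, smul_one_add_mul_smul_one_sub hψ, smul_smul, inv_mul_cancel₀ hne, one_smul]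
  have hba : ((x ^ 2 - c)⁻¹ • (x • (1 : End K V) - ψ)) * (x • 1 + ψ) = 1 := by
    rw [smul_mul_assoc, smul_one_sub_mul_smul_one_add hψ, smul_smul, inv_mul_cancel₀ hne, one_smul]
  exact ⟨⟨_, _, hab, hba⟩, rfl⟩

/-- **Degeneracy is detected.** In characteristic `0`: if `ψ² = c·1` with `c ≠ 0`, some non-zero `φ`
anticommutes with `ψ`, and `x² = c`, then `x·1 + ψ` is NOT invertible (it kills the non-zero space
`(x·1 - ψ)V`; were it invertible, `ψ = x·1` would anticommute with `φ ≠ 0`, forcing `x = 0 = c`).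
research route, not a corollary; conditional on HC_CM plus one named minimal statement. [folklore] -/
theorem not_isUnit_smul_one_add_of_sq_eq [CharZero K] {φ ψ : End K V} {c : K}
    (hψ : ψ * ψ = c • (1 : End K V)) (h : φ * ψ = -(ψ * φ)) (hφ : φ ≠ 0) (hc : c ≠ 0) {x : K}
    (hx : x ^ 2 = c) : ¬ IsUnit (x • (1 : End K V) + ψ) := by
  intro hu
  obtain ⟨w, hw⟩ := hu
  -- `(x·1 + ψ)(x·1 - ψ) = 0`, so `x·1 - ψ = 0`
  have hzero : (x • (1 : End K V) + ψ) * (x • 1 - ψ) = 0 := by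
    rw [smul_one_add_mul_smul_one_sub hψ, hx, sub_self, zero_smul]
  have hsub : x • (1 : End K V) - ψ = 0 := by
    have := congrArg (fun g => (↑w⁻¹ : End K V) * g) hzero
    simpa [← mul_assoc, ← hw] using this
  have hψx : ψ = x • (1 : End K V) := (sub_eq_zero.mp hsub).symm
  -- then `φψ = -ψφ` reads `x φ = -x φ`, i.e. `(2x) φ = 0`
  have h2 : (2 * x) • φ = 0 := by
    have h' := h
    rw [hψx, mul_smul_comm, mul_one, smul_mul_assoc, one_mul] at h'
    rw [mul_smul, two_smul]
    exact add_eq_zero_iff_eq_neg.mpr h'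
  rcases smul_eq_zero.mp h2 with h0 | h0
  · have hx0 : x = 0 := by
      rcases mul_eq_zero.mp h0 with h00 | h00
      · exact absurd h00 two_ne_zero
      · exact h00
    apply hc
    rw [← hx, hx0]; ring
  · exact hφ h0

/-- If `ψ² = r²·1` then every `r v + ψ v` lies in the `r`-eigenspace of `ψ`.
research route, not a corollary; conditional on HC_CM plus one named minimal statement. [folklore] -/
theorem smul_add_apply_mem_eigenspace {ψ : End K V} {r : K} (hψ : ψ * ψ = (r ^ 2) • (1 : End K V))
    (v : V) : r • v + ψ v ∈ eigenspace ψ r := by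
  rw [mem_eigenspace_iff, map_add, map_smul, smul_add]
  have : ψ (ψ v) = (r ^ 2) • v := by
    have := LinearMap.congr_fun hψ v
    simpa using this
  rw [this, sq, mul_smul, add_comm]

/-- **`V = E_r + E_{-r}`** for `ψ² = r²·1`, `r ≠ 0` (characteristic `≠ 2` in the form `(2:K) ≠ 0`):
`v = (2r)⁻¹((r v + ψ v) - (-r v + ψ v))`… precisely `v = (2r)⁻¹(r v + ψ v) + (2r)⁻¹(r v - ψ v)`.
research route, not a corollary; conditional on HC_CM plus one named minimal statement. [folklore] -/
theorem eigenspace_sup_eigenspace_neg_eq_top_of_sq {ψ : End K V} {r : K}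
    (hψ : ψ * ψ = (r ^ 2) • (1 : End K V)) (hr : (2 : K) * r ≠ 0) :
    eigenspace ψ r ⊔ eigenspace ψ (-r) = ⊤ := by
  rw [eq_top_iff]
  intro v _
  have h1 : r • v + ψ v ∈ eigenspace ψ r := smul_add_apply_mem_eigenspace hψ v
  have hψ' : ψ * ψ = ((-r) ^ 2) • (1 : End K V) := by rw [neg_sq]; exact hψ
  have h2 : (-r) • v + ψ v ∈ eigenspace ψ (-r) := smul_add_apply_mem_eigenspace hψ' v
  have hv : v = (2 * r)⁻¹ • (r • v + ψ v) - (2 * r)⁻¹ • ((-r) • v + ψ v) := by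
    rw [← smul_sub, show r • v + ψ v - ((-r) • v + ψ v) = (2 * r) • v by
      rw [neg_smul, mul_smul, two_smul]; abel, smul_smul, inv_mul_cancel₀ hr, one_smul]
  rw [hv]
  exact Submodule.sub_mem _ (Submodule.mem_sup_left (Submodule.smul_mem _ _ h1))
    (Submodule.mem_sup_right (Submodule.smul_mem _ _ h2))

/-- For `r ≠ -r` the two eigenspaces meet trivially.
research route, not a corollary; conditional on HC_CM plus one named minimal statement. [folklore] -/
theorem eigenspace_inf_eigenspace_neg_eq_bot {ψ : End K V} {r : K} (hr : (2 : K) * r ≠ 0) :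
    eigenspace ψ r ⊓ eigenspace ψ (-r) = ⊥ := by
  have hne : r ≠ -r := by
    intro h
    apply hr
    have : r + r = 0 := by nth_rewrite 2 [h]; exact add_neg_cancel r
    rw [two_mul]; exact this
  exact ((Module.End.eigenspaces_iSupIndep ψ).pairwiseDisjoint hne).eq_bot

/-- **`2·dim E_r = dim V`**: for `ψ² = r²·1` (`2r ≠ 0`) and an injective `φ` anticommuting with `ψ`, each
eigenspace of `ψ` has half the dimension.  On `T₀Y` (`dim 6`): multiplicities `(3,3)`, index `∈ {0,3,6}`.
Locator: `TWO-TERM-NOGO-G23.md` §1, LEMMA D (ii) (the multiplicities `(n,n)` of `±√(2Nm v)`); the linear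
algebra itself is standard (eigenspace exchange by an anticommuting injective operator).
research route, not a corollary; conditional on HC_CM plus one named minimal statement.
[folklore; locator TWO-TERM-NOGO-G23 §1 LEMMA D (ii)] -/
theorem two_mul_finrank_eigenspace_eq_of_anticommute [FiniteDimensional K V] {φ ψ : End K V} {r : K}
    (hψ : ψ * ψ = (r ^ 2) • (1 : End K V)) (hr : (2 : K) * r ≠ 0) (h : φ * ψ = -(ψ * φ))
    (hφ : Function.Injective φ) :
    2 * finrank K (eigenspace ψ r) = finrank K V := by
  have hsum := Submodule.finrank_sup_add_finrank_inf_eq (eigenspace ψ r) (eigenspace ψ (-r))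
  rw [eigenspace_sup_eigenspace_neg_eq_top_of_sq hψ hr, eigenspace_inf_eigenspace_neg_eq_bot hr,
    finrank_top, finrank_bot, add_zero,
    ← finrank_eigenspace_eq_finrank_eigenspace_neg_of_anticommute h hφ r] at hsum
  omega

/-- **THE CELL: no degenerate divisor class in the `D₆`-plane.**  If `ψ² = 2(z² + 3y²)·1` with
`(y, z) ≠ (0, 0)` — the square of `ψ_v = (z + yφ)β ∈ D₆ = (-3,2)_ℚ` for `v = y a + z b ≠ 0` — then
`x·1 + ψ` is invertible for EVERY `x ∈ ℚ`: the class `x u + v` is non-degenerate, because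
`x² = 2(z² + 3y²)` would make `2` a norm from `ℚ(√-3)` (`norm3_ne_two_mul_norm3`, p304276).  Hence on
`𝔔` every non-zero class of the `D₆`-plane has index `0`, `3` or `6` (with
`two_mul_finrank_eigenspace_eq_of_anticommute`), never `2`: the hypothesis `H²(L_p ⊗ L_n⁻¹) = 0` of
THEOREM N (TWO-TERM-NOGO-G23 §2) holds for free.
This is a CELL-SPECIFIC statement, not folklore: it consumes the tree theorem
`Summit.HodgeConjecture.Ring2AbelianAll.NonsplitWeilSurfaceQuaternion.norm3_ne_two_mul_norm3` (p304276,
`Ring2AbelianAllNonsplitWeilSurfaceQuaternion.lean`: `2 ∉ Nm ℚ(√-3)ˣ`); locator of the statement: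
`TWO-TERM-NOGO-G23.md` §1, LEMMA D (iii)–(iv) (seat WEIL-2, gen 23).
research route, not a corollary; conditional on HC_CM plus one named minimal statement.
[tree: NonsplitWeilSurfaceQuaternion.norm3_ne_two_mul_norm3 (p304276); locator TWO-TERM-NOGO-G23 §1 LEMMA D] -/
theorem isUnit_smul_one_add_of_sq_eq_two_mul_norm3 {W : Type*} [AddCommGroup W] [Module ℚ W]
    {ψ : End ℚ W} {y z : ℚ} (hψ : ψ * ψ = (2 * (z ^ 2 + 3 * y ^ 2)) • (1 : End ℚ W))
    (hyz : ¬ (y = 0 ∧ z = 0)) (x : ℚ) : IsUnit (x • (1 : End ℚ W) + ψ) := by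
  refine isUnit_smul_one_add_of_sq_ne hψ ?_
  intro hx
  have h := norm3_ne_two_mul_norm3 x 0 z y (by rw [hx]; ring)
  exact hyz ⟨h.2.2.2, h.2.2.1⟩

end Summit.HodgeConjecture.Ring2AbelianAll.NonsplitTypeIIIndexLaw
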